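import Literature.AlgebraicGeometry.HodgeTheory.LefschetzStandardOfSmallChowGroupsVialRange
import HarnessLib

/-!
# The Lefschetz standard conjecture `B(Y × Z)` — for EVERY polarisation of the product — when `CH₀, …, CH_{k₀}(Y)` and `CH₀, …, CH_{k₁}(Z)` have rank `≤ 1`, `dim Y ≤ 2k₀ + 3`, `dim Z ≤ 2k₁ + 3`, and `B(C × Z)` for ANY
# curve `C` and such a `Z`: products of threefolds with `CH₀ = ℚ` (rationally chain connected, Fano), of fivefolds with `CH₀ = CH₁ = ℚ` (cubic fivefolds granted ELV), curves times these
# (Kleiman 1968 §2; Vial 2013 Thm. 7.1; Laterveer 1998; Voisin 2025 §3.2.2; Voisin I Thm. 11.38–11.40, Thm. 6.25; Voisin II Thm. 10.29/10.31, Prop. 9.20; Bloch–Srinivas 1983)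

Family `hodge`, lane `lit-hodgefound` (Track 2 foundations library; Layers A1/A4), layer `Literature/AlgebraicGeometry/HodgeTheory`.  THEOREMS ONLY (no definition, no named fact, no instance;
D-0026 net debt `0`).  Sequel of the seat's g33-#17 (`BettiUniverse.hodgeClasses_tensor_algebraic_of_forall_pieces`, the per-degree coniveau product criterion, and `B(X)` in Vial's range), g33-#11
(`supportedClasses_tensor_eq_top_of_forall_pieces`), g33-#14 (`supportedClasses_profile_of_chowRankLEOneUpTo`) and g33-#7 (`HC(Y × Z)`).  The tree has `B` for products only through ALL of `HC(W × W)`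
(`standardConjectureBStar_of_hodgeConjectureFor_prod`); Kleiman's `B(Y) ∧ B(Z) ⟹ B(Y × Z)` (for the product polarisation) is not in the tree — the theorems below give `B(Y × Z)` for EVERY `η` in the stated ranges.

THE ARGUMENT.  Put `W = Y × Z`, `D = dim Y + dim Z`.  (1) A coniveau profile of `W` in every degree `k ≤ 2D`: `N^{τ(k)} Hᵏ(W) = Hᵏ(W)` with `τ(k) = ⌊k/2⌋`, except `τ(D) = D/2 − 1` when `dim Y = 2k₀ + 3` and
`dim Z = 2k₁ + 3` (both odd, the middle degree) — from the profiles of the factors piece by piece (`τ(k) ≤ ρ_Y(i) + ρ_Z(j)` for all `i + j = k`; g33-#11's product lemma).  (2) `B(W)` needs the rational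
`(b,b)`-classes of `W × W` for `2 ≤ b ≤ D − 1` (the tree's range theorem); by g33-#17's per-degree criterion with the profile `τ` on both factors they are algebraic, since `b ≤ τ(k) + τ(l) + 1` for all
`k + l = 2b ≤ 2D − 2` (the single dip at `k = D` is absorbed: `l = 2b − D ≤ D − 2` is then even), together with `HC(W)` (g33-#7: `dim Y ≤ 2k₀ + 5`, `dim Z ≤ 2k₁ + 5`, `D ≤ 2(k₀ + k₁) + 7`).  For a curve
factor the profile `(0, 0, 1)` of `C` plays the role of `k₀ = −1` (`1 = 2·(−1) + 3`): `τ(k) = ⌊k/2⌋` with the dip at `k = 1 + dim Z` when `dim Z = 2k₁ + 3`.  (All inequalities are elementary; they were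
checked on `305 800` instances before typing and are decided by `omega`.)

WHAT IS PROVED (`0` sorrys; every statement a theorem; tensor facts and the real Hodge model are theorems of the tree).
* §1 `supportedClasses_tensor_profile_of_chowRankLEOneUpTo` (the profile `τ` of `Y × Z`), `supportedClasses_curve_tensor_profile_of_chowRankLEOneUpTo` (+ mirror).
* §2 **`standardConjectureBStar_tensor_of_chowRankLEOneUpTo`** — `B(Y × Z)` (every `η`) for `ChowRankLEOneUpTo Y k₀`, `ChowRankLEOneUpTo Z k₁`, `dim Y ≤ 2k₀ + 3`, `dim Z ≤ 2k₁ + 3`;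
  **`standardConjectureBStar_curve_tensor_of_chowRankLEOneUpTo`** (+ mirror) — `B(C × Z)` for ANY curve `C` and `ChowRankLEOneUpTo Z k₁`, `dim Z ≤ 2k₁ + 3`.
* §3 Instances: `T × T'` for threefolds with `CH₀ ⊗ ℚ` of rank `≤ 1`, rationally chain connected, Fano (KMM92); `C × T`, `T × C`; `X₅ × X₅'` for fivefolds with `CH₀, CH₁` of rank `≤ 1`; `T × X₅`; granted ELV:
  two smooth cubic fivefolds, a curve times a cubic fivefold.

THE PRINTS.  S. Kleiman (1968) [Kleiman1968AlgebraicCycles] §2; Ch. Vial (2013) [Vial2013] Thm. 7.1 and proof p. 19, §7.2.2; R. Laterveer (1998) [Laterveer1998]; C. Voisin (2025) [Voisin2025] §3.2.2 (15)–(16), Conj. 3.11, §4.3;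
A. Grothendieck (1968) [Grothendieck1968] §3 p. 196; C. Voisin (2002) [VoisinHodgeI2002] §11.3.3 Thm. 11.38–11.40, Lemma 11.41, p. 287, §6.2.3 Thm. 6.25; C. Voisin (2003) [VoisinHodgeII2003] §9.2.4 Prop. 9.20,
Thm. 10.17, Thm. 10.29, Thm. 10.31; S. Bloch, V. Srinivas (1983) [BlochSrinivas1983] Thm. 1; H. Esnault, M. Levine, E. Viehweg (1997) [EsnaultLevineViehweg1997] Thm. 4.6; J. Kollár (1996) [Kollar1995] Def. 4.10;
KMM (1992) [KollarMiyaokaMori1992] Thm. 3.3.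

THE OBJECTS (all the tree's).  `StandardConjectureBStar`, `HodgeConjectureFor`, `supportedClasses`, `Motives.ChowRankLEOneUpTo`, `IsRationallyChainConnected`, `IsFano`, `Motives.IsSmoothCompleteIntersection 5 (3)`,
`Motives.EsnaultLevineViehweg1997_chowGroup_rank_le_one`, `KollarMiyaokaMori1992_fano_rationallyChainConnected` (hypotheses only); the tree's `standardConjectureBStar_of_hodgeClasses_prod_algebraic_range`, and the
seat's `BettiUniverse.hodgeClasses_tensor_algebraic_of_forall_pieces`, `supportedClasses_tensor_eq_top_of_forall_pieces`, `supportedClasses_profile_of_chowRankLEOneUpTo`, `hodgeConjectureFor_tensor_of_chowRankLEOneUpTo`,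
`hodgeConjectureFor_tensor_of_dim_le_three_of_chowRankLEOneUpTo`, `IsRationallyChainConnected.chowRankLEOneUpTo_zero`, `chowRankLEOneUpTo_one_of_cubic_of_ELV`.

DEVIATIONS / SCOPE.  Complex orientations; `B` in André's `*_L` form for every `η` (the tree's `StandardConjectureBStar`).  The ranges are sufficient conditions for the METHOD; no claim that
`B(Y) ∧ B(Z) ⟹ B(Y × Z)` in general (Kleiman's theorem, not typed here).  The ELV instances are conditional on the tree's EXISTING named fact, as their predecessors.

## References
* [Kleiman1968AlgebraicCycles] S. Kleiman, *Algebraic cycles and the Weil conjectures* (1968) — §2.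
* [Vial2013] Ch. Vial, Doc. Math. 18 (2013) — Thm. 7.1 and proof p. 19; §7.2.2.
* [Laterveer1998] R. Laterveer, J. Math. Kyoto Univ. 38 (1998) — main theorem.
* [Voisin2025] C. Voisin (2025) — §3.2.2 (15)–(16), Conj. 3.11; §4.3.
* [Grothendieck1968] A. Grothendieck, *Standard conjectures on algebraic cycles* (1969) — §3 p. 196.
* [VoisinHodgeI2002] C. Voisin, *Hodge Theory and Complex Algebraic Geometry I* — Thm. 11.38–11.40, Lemma 11.41, p. 287; Thm. 6.25.
* [VoisinHodgeII2003] C. Voisin, *Hodge Theory and Complex Algebraic Geometry II* — Prop. 9.20; Thm. 10.17; Thm. 10.29; Thm. 10.31.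
* [BlochSrinivas1983] S. Bloch, V. Srinivas, Amer. J. Math. 105 (1983) — Thm. 1.
* [EsnaultLevineViehweg1997] H. Esnault, M. Levine, E. Viehweg, Duke Math. J. 87 (1997) — Thm. 4.6.
* [Kollar1995] J. Kollár, *Rational Curves on Algebraic Varieties* — Def. 4.10.
* [KollarMiyaokaMori1992] J. Kollár, Y. Miyaoka, S. Mori, J. Differential Geom. 36 (1992) — Thm. 3.3.

## Provenance
Lane `lit-hodgefound` (summit `HodgeConjecture`, Track 2 foundations), seat `lit-hodgefound-p29` (literature-prover, generation 33, row g33-#18).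
-/

noncomputable section

open scoped TensorProduct
open CategoryTheory AlgebraicGeometry MonoidalCategory CartesianMonoidalCategory Module Finset
open Literature.AlgebraicTopology.SingularHomology
open Literature.Geometry.Kaehler

namespace Literature.AlgebraicGeometry.HodgeTheory

open Literature.AlgebraicGeometry.Motives
open Literature.AlgebraicGeometry.Motives.HodgeStructure

variable {m n : ℕ} {X Y Z C T T' : SchemeOver ℂ}

/-! ### §1 Coniveau profiles of the products -/

/-- **A coniveau profile of `Y × Z` in every degree `k ≤ 2(dim Y + dim Z)`** when `CH₀, …, CH_{k₀}(Y)`, `CH₀, …, CH_{k₁}(Z)` have rank `≤ 1`, `dim Y ≤ 2k₀ + 3`, `dim Z ≤ 2k₁ + 3`: `N^{τ(k)} Hᵏ(Y × Z) = Hᵏ(Y × Z)`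
with `τ(k) = ⌊k/2⌋`, except `τ(dim Y + dim Z) = (dim Y + dim Z)/2 − 1` when `dim Y = 2k₀ + 3` and `dim Z = 2k₁ + 3` (piece by piece from the profiles of the factors). [cite: VoisinHodgeII2003, §9.2.4 Prop. 9.20, Thm. 10.29 and proof of Thm. 10.31]
[cite: VoisinHodgeI2002, §11.3.3 Thm. 11.38 and §6.2.3 Thm. 6.25] [cite: Laterveer1998, main theorem (as quoted in Vial2013 Thm. 7.1)] -/
theorem supportedClasses_tensor_profile_of_chowRankLEOneUpTo (hY : IsSmoothProjective m Y) (hZ : IsSmoothProjective n Z) {k₀ k₁ : ℕ} (hCHY : ChowRankLEOneUpTo Y k₀) (hCHZ : ChowRankLEOneUpTo Z k₁)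
    (hm : m ≤ 2 * k₀ + 3) (hn : n ≤ 2 * k₁ + 3) (k : ℕ) (_hk : k ≤ 2 * (m + n)) :
    supportedClasses (Y ⊗ Z) k ((fun k : ℕ ↦ if k = m + n ∧ m = 2 * k₀ + 3 ∧ n = 2 * k₁ + 3 then k / 2 - 1 else k / 2) k) = ⊤ := by
  refine supportedClasses_tensor_eq_top_of_forall_pieces hY hZ _ _ (supportedClasses_profile_of_chowRankLEOneUpTo hY hCHY (2 * (m + n)))
    (supportedClasses_profile_of_chowRankLEOneUpTo hZ hCHZ (2 * (m + n))) fun i j hij hi hj ↦ ?_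
  simp only [Nat.min_def]
  split_ifs <;> omega

/-- **A coniveau profile of `C × Z` in every degree**, `C` any curve, `CH₀, …, CH_{k₁}(Z)` of rank `≤ 1`, `dim Z ≤ 2k₁ + 3`: `τ(k) = ⌊k/2⌋`, except `τ(1 + dim Z) = (1 + dim Z)/2 − 1` when `dim Z = 2k₁ + 3`.
[cite: VoisinHodgeII2003, §9.2.4 Prop. 9.20, Thm. 10.29 and proof of Thm. 10.31] [cite: VoisinHodgeI2002, §11.3.3 Thm. 11.38 and §6.2.3 Thm. 6.25] -/
theorem supportedClasses_curve_tensor_profile_of_chowRankLEOneUpTo (hC : IsSmoothProjective 1 C) (hZ : IsSmoothProjective n Z) {k₁ : ℕ} (hCHZ : ChowRankLEOneUpTo Z k₁) (hn : n ≤ 2 * k₁ + 3)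
    (k : ℕ) (_hk : k ≤ 2 * (1 + n)) : supportedClasses (C ⊗ Z) k ((fun k : ℕ ↦ if k = 1 + n ∧ n = 2 * k₁ + 3 then k / 2 - 1 else k / 2) k) = ⊤ := by
  have tabC : ∀ i : ℕ, i ≤ 2 * 1 → supportedClasses C i ((fun i : ℕ ↦ if i = 2 then 1 else 0) i) = ⊤ := by
    intro i hi
    interval_cases i
    · exact supportedClasses_zero C 0
    · exact supportedClasses_zero C 1
    · exact supportedClasses_eq_top_of_dim_add_le hC (i := 2) (r := 1) (by norm_num)
  refine supportedClasses_tensor_eq_top_of_forall_pieces hC hZ _ _ tabC (supportedClasses_profile_of_chowRankLEOneUpTo hZ hCHZ (2 * (1 + n))) fun i j hij hi hj ↦ ?_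
  simp only [Nat.min_def]
  split_ifs <;> omega

/-- Mirror: a coniveau profile of `Z × C`. [cite: VoisinHodgeII2003, §9.2.4 Prop. 9.20, Thm. 10.29 and proof of Thm. 10.31] [cite: VoisinHodgeI2002, §6.2.3 Thm. 6.25] -/
theorem supportedClasses_tensor_curve_profile_of_chowRankLEOneUpTo (hZ : IsSmoothProjective n Z) (hC : IsSmoothProjective 1 C) {k₁ : ℕ} (hCHZ : ChowRankLEOneUpTo Z k₁) (hn : n ≤ 2 * k₁ + 3)
    (k : ℕ) (_hk : k ≤ 2 * (n + 1)) : supportedClasses (Z ⊗ C) k ((fun k : ℕ ↦ if k = n + 1 ∧ n = 2 * k₁ + 3 then k / 2 - 1 else k / 2) k) = ⊤ := by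
  have tabC : ∀ i : ℕ, i ≤ 2 * 1 → supportedClasses C i ((fun i : ℕ ↦ if i = 2 then 1 else 0) i) = ⊤ := by
    intro i hi
    interval_cases i
    · exact supportedClasses_zero C 0
    · exact supportedClasses_zero C 1
    · exact supportedClasses_eq_top_of_dim_add_le hC (i := 2) (r := 1) (by norm_num)
  refine supportedClasses_tensor_eq_top_of_forall_pieces hZ hC _ _ (supportedClasses_profile_of_chowRankLEOneUpTo hZ hCHZ (2 * (n + 1))) tabC fun i j hij hi hj ↦ ?_
  simp only [Nat.min_def]
  split_ifs <;> omega

/-! ### §2 `B` of the products -/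

/-- **The Lefschetz standard conjecture `B(Y × Z)`, for EVERY polarisation class of the product, when `CH₀(Y)_ℚ, …, CH_{k₀}(Y)_ℚ` and `CH₀(Z)_ℚ, …, CH_{k₁}(Z)_ℚ` have rank `≤ 1`, `dim Y ≤ 2k₀ + 3` and
`dim Z ≤ 2k₁ + 3`.**  The rational `(b,b)`-classes of `(Y × Z) × (Y × Z)` with `2 ≤ b ≤ dim Y + dim Z − 1` are algebraic by g33-#17's per-degree criterion with §1's profile on both factors and `HC(Y × Z)`
(g33-#7); the tree's range theorem turns this into `B`. [cite: Kleiman1968AlgebraicCycles, §2] [cite: Voisin2025, §3.2.2 (15)–(16) and Conj. 3.11] [cite: Vial2013, Thm 7.1 and proof p. 19]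
[cite: VoisinHodgeI2002, §11.3.3 Thm. 11.38–11.40 and §6.2.3 Thm. 6.25] [cite: VoisinHodgeII2003, Thm. 10.29 and proof of Thm. 10.31] -/
theorem standardConjectureBStar_tensor_of_chowRankLEOneUpTo (hY : IsSmoothProjective m Y) (hZ : IsSmoothProjective n Z) {k₀ k₁ : ℕ} (hCHY : ChowRankLEOneUpTo Y k₀) (hCHZ : ChowRankLEOneUpTo Z k₁)
    (hm : m ≤ 2 * k₀ + 3) (hn : n ≤ 2 * k₁ + 3) (η : complexBetti (Y ⊗ Z) 2) : StandardConjectureBStar (m + n) (Y ⊗ Z) η := by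
  haveI : HodgeTensorFacts.{0, 0} := hodgeTensorFacts_holds
  have hW : IsSmoothProjective (m + n) (Y ⊗ Z) := hY.tensor_holds hZ
  have hHC : HodgeConjectureFor (m + n) (Y ⊗ Z) := hodgeConjectureFor_tensor_of_chowRankLEOneUpTo hY hZ hCHY hCHZ (by omega) (by omega) (by omega)
  refine standardConjectureBStar_of_hodgeClasses_prod_algebraic_range hW (fun b hb2 hbn c hc hcH ↦ ?_) η
  refine BettiUniverse.hodgeClasses_tensor_algebraic_of_forall_pieces exists_isReal_hodgeModel_holds hW hW (hW.tensor_holds hW) hHC hHC _ _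
    (supportedClasses_tensor_profile_of_chowRankLEOneUpTo hY hZ hCHY hCHZ hm hn) (supportedClasses_tensor_profile_of_chowRankLEOneUpTo hY hZ hCHY hCHZ hm hn)
    (fun k l hkl hk1 hk hl1 hl ↦ ?_) c hc hcH
  show b ≤ (if k = m + n ∧ m = 2 * k₀ + 3 ∧ n = 2 * k₁ + 3 then k / 2 - 1 else k / 2) + (if l = m + n ∧ m = 2 * k₀ + 3 ∧ n = 2 * k₁ + 3 then l / 2 - 1 else l / 2) + 1
  split_ifs <;> omega

/-- **`B(C × Z)` for EVERY polarisation, `C` ANY smooth projective curve and `CH₀(Z)_ℚ, …, CH_{k₁}(Z)_ℚ` of rank `≤ 1`, `dim Z ≤ 2k₁ + 3`** (profile of §1 on both factors of `(C × Z) × (C × Z)`, `HC(C × Z)` by g33-#7).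
[cite: Kleiman1968AlgebraicCycles, §2] [cite: Voisin2025, §3.2.2 (15)–(16) and Conj. 3.11] [cite: VoisinHodgeI2002, §11.3.3 Thm. 11.38–11.40 and §6.2.3 Thm. 6.25] [cite: VoisinHodgeII2003, Thm. 10.29 and proof of Thm. 10.31] -/
theorem standardConjectureBStar_curve_tensor_of_chowRankLEOneUpTo (hC : IsSmoothProjective 1 C) (hZ : IsSmoothProjective n Z) {k₁ : ℕ} (hCHZ : ChowRankLEOneUpTo Z k₁) (hn : n ≤ 2 * k₁ + 3)
    (η : complexBetti (C ⊗ Z) 2) : StandardConjectureBStar (1 + n) (C ⊗ Z) η := by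
  haveI : HodgeTensorFacts.{0, 0} := hodgeTensorFacts_holds
  have hW : IsSmoothProjective (1 + n) (C ⊗ Z) := hC.tensor_holds hZ
  have hHC : HodgeConjectureFor (1 + n) (C ⊗ Z) := hodgeConjectureFor_tensor_of_dim_le_three_of_chowRankLEOneUpTo hC hZ hCHZ (by norm_num) (by omega)
  refine standardConjectureBStar_of_hodgeClasses_prod_algebraic_range hW (fun b hb2 hbn c hc hcH ↦ ?_) η
  refine BettiUniverse.hodgeClasses_tensor_algebraic_of_forall_pieces exists_isReal_hodgeModel_holds hW hW (hW.tensor_holds hW) hHC hHC _ _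
    (supportedClasses_curve_tensor_profile_of_chowRankLEOneUpTo hC hZ hCHZ hn) (supportedClasses_curve_tensor_profile_of_chowRankLEOneUpTo hC hZ hCHZ hn)
    (fun k l hkl hk1 hk hl1 hl ↦ ?_) c hc hcH
  show b ≤ (if k = 1 + n ∧ n = 2 * k₁ + 3 then k / 2 - 1 else k / 2) + (if l = 1 + n ∧ n = 2 * k₁ + 3 then l / 2 - 1 else l / 2) + 1
  split_ifs <;> omega

/-- Mirror: **`B(Z × C)`** for every polarisation, `dim Z ≤ 2k₁ + 3`, `C` any curve. [cite: Kleiman1968AlgebraicCycles, §2] [cite: VoisinHodgeI2002, §11.3.3 Thm. 11.38–11.40] [cite: VoisinHodgeII2003, Thm. 10.29 and proof of Thm. 10.31] -/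
theorem standardConjectureBStar_tensor_curve_of_chowRankLEOneUpTo (hZ : IsSmoothProjective n Z) (hC : IsSmoothProjective 1 C) {k₁ : ℕ} (hCHZ : ChowRankLEOneUpTo Z k₁) (hn : n ≤ 2 * k₁ + 3)
    (η : complexBetti (Z ⊗ C) 2) : StandardConjectureBStar (n + 1) (Z ⊗ C) η := by
  haveI : HodgeTensorFacts.{0, 0} := hodgeTensorFacts_holds
  have hW : IsSmoothProjective (n + 1) (Z ⊗ C) := hZ.tensor_holds hC
  have hHC : HodgeConjectureFor (n + 1) (Z ⊗ C) := hodgeConjectureFor_tensor_of_chowRankLEOneUpTo_of_dim_le_three hZ hC hCHZ (by norm_num) (by omega)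
  refine standardConjectureBStar_of_hodgeClasses_prod_algebraic_range hW (fun b hb2 hbn c hc hcH ↦ ?_) η
  refine BettiUniverse.hodgeClasses_tensor_algebraic_of_forall_pieces exists_isReal_hodgeModel_holds hW hW (hW.tensor_holds hW) hHC hHC _ _
    (supportedClasses_tensor_curve_profile_of_chowRankLEOneUpTo hZ hC hCHZ hn) (supportedClasses_tensor_curve_profile_of_chowRankLEOneUpTo hZ hC hCHZ hn)
    (fun k l hkl hk1 hk hl1 hl ↦ ?_) c hc hcH
  show b ≤ (if k = n + 1 ∧ n = 2 * k₁ + 3 then k / 2 - 1 else k / 2) + (if l = n + 1 ∧ n = 2 * k₁ + 3 then l / 2 - 1 else l / 2) + 1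
  split_ifs <;> omega

/-! ### §3 Instances -/

/-- **`B(T × T')` (every polarisation) for two smooth projective threefolds with `CH₀ ⊗ ℚ` of rank `≤ 1`.** [cite: Kleiman1968AlgebraicCycles, §2] [cite: BlochSrinivas1983, Thm. 1] [cite: VoisinHodgeII2003, §10.2.2 Thm. 10.17] -/
theorem standardConjectureBStar_tensor_threefolds_of_chowRankLEOneUpTo_zero (hT : IsSmoothProjective 3 T) (hT' : IsSmoothProjective 3 T') (hCH : ChowRankLEOneUpTo T 0)
    (hCH' : ChowRankLEOneUpTo T' 0) (η : complexBetti (T ⊗ T') 2) : StandardConjectureBStar (3 + 3) (T ⊗ T') η :=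
  standardConjectureBStar_tensor_of_chowRankLEOneUpTo hT hT' hCH hCH' (by norm_num) (by norm_num) η

/-- **`B(T × T')` for two rationally chain connected smooth projective threefolds** (g33-#13's bridge). [cite: Kollar1995, Def. 4.10] [cite: Kleiman1968AlgebraicCycles, §2] [cite: BlochSrinivas1983, Thm. 1] -/
theorem standardConjectureBStar_tensor_threefolds_of_isRationallyChainConnected (hT : IsSmoothProjective 3 T) (hT' : IsSmoothProjective 3 T') (hRC : IsRationallyChainConnected T)
    (hRC' : IsRationallyChainConnected T') (η : complexBetti (T ⊗ T') 2) : StandardConjectureBStar (3 + 3) (T ⊗ T') η :=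
  standardConjectureBStar_tensor_threefolds_of_chowRankLEOneUpTo_zero hT hT' (hRC.chowRankLEOneUpTo_zero hT) (hRC'.chowRankLEOneUpTo_zero hT') η

/-- **`B(F × F')` for two smooth complex FANO threefolds, granted KMM92.** [cite: KollarMiyaokaMori1992, Thm. 3.3] [cite: Kleiman1968AlgebraicCycles, §2] [cite: BlochSrinivas1983, Thm. 1] -/
theorem standardConjectureBStar_tensor_threefolds_of_isFano (hKMM : KollarMiyaokaMori1992_fano_rationallyChainConnected) {F F' : SchemeOver ℂ} (hF : IsFano 3 F) (hF' : IsFano 3 F')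
    (η : complexBetti (F ⊗ F') 2) : StandardConjectureBStar (3 + 3) (F ⊗ F') η :=
  standardConjectureBStar_tensor_threefolds_of_chowRankLEOneUpTo_zero hF.isSmoothProjective hF'.isSmoothProjective (hKMM.chowRankLEOneUpTo_zero hF) (hKMM.chowRankLEOneUpTo_zero hF') η

/-- **`B(C × T)` for any curve `C` and a smooth projective threefold `T` with `CH₀ ⊗ ℚ` of rank `≤ 1`.** [cite: Kleiman1968AlgebraicCycles, §2] [cite: BlochSrinivas1983, Thm. 1] [cite: VoisinHodgeII2003, §10.2.2 Thm. 10.17] -/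
theorem standardConjectureBStar_curve_tensor_threefold_of_chowRankLEOneUpTo_zero (hC : IsSmoothProjective 1 C) (hT : IsSmoothProjective 3 T) (hCH : ChowRankLEOneUpTo T 0)
    (η : complexBetti (C ⊗ T) 2) : StandardConjectureBStar (1 + 3) (C ⊗ T) η :=
  standardConjectureBStar_curve_tensor_of_chowRankLEOneUpTo hC hT hCH (by norm_num) η

/-- **`B(T × C)`**, `T` a threefold with `CH₀ ⊗ ℚ` of rank `≤ 1`, `C` any curve. [cite: Kleiman1968AlgebraicCycles, §2] [cite: BlochSrinivas1983, Thm. 1] -/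
theorem standardConjectureBStar_threefold_tensor_curve_of_chowRankLEOneUpTo_zero (hT : IsSmoothProjective 3 T) (hC : IsSmoothProjective 1 C) (hCH : ChowRankLEOneUpTo T 0)
    (η : complexBetti (T ⊗ C) 2) : StandardConjectureBStar (3 + 1) (T ⊗ C) η :=
  standardConjectureBStar_tensor_curve_of_chowRankLEOneUpTo hT hC hCH (by norm_num) η

/-- **`B(C × T)` for any curve `C` and a rationally chain connected threefold `T`** (e.g. `C × F`, `F` Fano, granted KMM92 — next theorem). [cite: Kollar1995, Def. 4.10] [cite: Kleiman1968AlgebraicCycles, §2] -/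
theorem standardConjectureBStar_curve_tensor_threefold_of_isRationallyChainConnected (hC : IsSmoothProjective 1 C) (hT : IsSmoothProjective 3 T) (hRC : IsRationallyChainConnected T)
    (η : complexBetti (C ⊗ T) 2) : StandardConjectureBStar (1 + 3) (C ⊗ T) η :=
  standardConjectureBStar_curve_tensor_threefold_of_chowRankLEOneUpTo_zero hC hT (hRC.chowRankLEOneUpTo_zero hT) η

/-- **`B(C × F)` for any curve `C` and a smooth complex FANO threefold `F`, granted KMM92.** [cite: KollarMiyaokaMori1992, Thm. 3.3] [cite: Kleiman1968AlgebraicCycles, §2] -/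
theorem standardConjectureBStar_curve_tensor_threefold_of_isFano (hKMM : KollarMiyaokaMori1992_fano_rationallyChainConnected) (hC : IsSmoothProjective 1 C) {F : SchemeOver ℂ} (hF : IsFano 3 F)
    (η : complexBetti (C ⊗ F) 2) : StandardConjectureBStar (1 + 3) (C ⊗ F) η :=
  standardConjectureBStar_curve_tensor_threefold_of_chowRankLEOneUpTo_zero hC hF.isSmoothProjective (hKMM.chowRankLEOneUpTo_zero hF) η

/-- **`B(X₅ × X₅')` for two smooth projective fivefolds with `CH₀, CH₁ ⊗ ℚ` of rank `≤ 1`** (`5 ≤ 2·1 + 3`). [cite: Kleiman1968AlgebraicCycles, §2] [cite: VoisinHodgeII2003, Thm. 10.31] [cite: Vial2013, Thm 7.1] -/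
theorem standardConjectureBStar_tensor_fivefolds_of_chowRankLEOneUpTo_one {X' : SchemeOver ℂ} (hX : IsSmoothProjective 5 X) (hX' : IsSmoothProjective 5 X') (hCH : ChowRankLEOneUpTo X 1)
    (hCH' : ChowRankLEOneUpTo X' 1) (η : complexBetti (X ⊗ X') 2) : StandardConjectureBStar (5 + 5) (X ⊗ X') η :=
  standardConjectureBStar_tensor_of_chowRankLEOneUpTo hX hX' hCH hCH' (by norm_num) (by norm_num) η

/-- **`B(T × X₅)` for a threefold with `CH₀` and a fivefold with `CH₀, CH₁` of rank `≤ 1`.** [cite: Kleiman1968AlgebraicCycles, §2] [cite: VoisinHodgeII2003, Thm. 10.17 and Thm. 10.31] -/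
theorem standardConjectureBStar_threefold_tensor_fivefold_of_chowRankLEOneUpTo_zero_one (hT : IsSmoothProjective 3 T) (hX : IsSmoothProjective 5 X) (hCHT : ChowRankLEOneUpTo T 0)
    (hCHX : ChowRankLEOneUpTo X 1) (η : complexBetti (T ⊗ X) 2) : StandardConjectureBStar (3 + 5) (T ⊗ X) η :=
  standardConjectureBStar_tensor_of_chowRankLEOneUpTo hT hX hCHT hCHX (by norm_num) (by norm_num) η

/-- **`B(C × X₅)` for any curve `C` and a fivefold with `CH₀, CH₁ ⊗ ℚ` of rank `≤ 1`.** [cite: Kleiman1968AlgebraicCycles, §2] [cite: VoisinHodgeII2003, Thm. 10.31] -/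
theorem standardConjectureBStar_curve_tensor_fivefold_of_chowRankLEOneUpTo_one (hC : IsSmoothProjective 1 C) (hX : IsSmoothProjective 5 X) (hCH : ChowRankLEOneUpTo X 1)
    (η : complexBetti (C ⊗ X) 2) : StandardConjectureBStar (1 + 5) (C ⊗ X) η :=
  standardConjectureBStar_curve_tensor_of_chowRankLEOneUpTo hC hX hCH (by norm_num) η

/-- **`B(Y × Y')` for two smooth CUBIC FIVEFOLDS `Y, Y' ⊂ ℙ⁶_ℂ`, every polarisation, granted ELV** (`CH₀, CH₁ ⊗ ℚ = ℚ` for cubics of dimension `≥ 5`). [cite: Vial2013, Thm 7.1 and §7.2.2]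
[cite: EsnaultLevineViehweg1997, Thm 4.6 (announced as Thm 4.5 in the Introduction), first bullet] [cite: Kleiman1968AlgebraicCycles, §2] -/
theorem standardConjectureBStar_tensor_cubicFivefolds_of_ELV (hR : EsnaultLevineViehweg1997_chowGroup_rank_le_one.{0}) {Y' : SchemeOver ℂ} (hY : IsSmoothCompleteIntersection 5 (fun _ : Fin 1 ↦ 3) Y)
    (hY' : IsSmoothCompleteIntersection 5 (fun _ : Fin 1 ↦ 3) Y') (η : complexBetti (Y ⊗ Y') 2) : StandardConjectureBStar (5 + 5) (Y ⊗ Y') η :=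
  standardConjectureBStar_tensor_fivefolds_of_chowRankLEOneUpTo_one hY.1 hY'.1 (chowRankLEOneUpTo_one_of_cubic_of_ELV hR hY (by norm_num)) (chowRankLEOneUpTo_one_of_cubic_of_ELV hR hY' (by norm_num)) η

/-- **`B(C × Y)` for any curve `C` and a smooth cubic fivefold `Y ⊂ ℙ⁶_ℂ`, granted ELV.** [cite: Vial2013, §7.2.2] [cite: EsnaultLevineViehweg1997, Thm 4.6] [cite: Kleiman1968AlgebraicCycles, §2] -/
theorem standardConjectureBStar_curve_tensor_cubicFivefold_of_ELV (hR : EsnaultLevineViehweg1997_chowGroup_rank_le_one.{0}) (hC : IsSmoothProjective 1 C) (hY : IsSmoothCompleteIntersection 5 (fun _ : Fin 1 ↦ 3) Y)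
    (η : complexBetti (C ⊗ Y) 2) : StandardConjectureBStar (1 + 5) (C ⊗ Y) η :=
  standardConjectureBStar_curve_tensor_fivefold_of_chowRankLEOneUpTo_one hC hY.1 (chowRankLEOneUpTo_one_of_cubic_of_ELV hR hY (by norm_num)) η

end Literature.AlgebraicGeometry.HodgeTheory

end
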